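import Summits.AtomisticToContinuum.Crystallization.Theorems.PalmUnimodularRigidityMinimiserShellsEnergyFloorB
import HarnessLib

/-!
# Measurable versions of mark functionals (stub T2 `stub_markMeasurable` of line `palm-good-law`,
# crux `ReggeStarCoercivity.DefectFreeCrystallizes`, stmt-AtomisticToContinuum-13603)

**Theorem** (`stub_markMeasurable`).  Let `δ > 0` and let `k : (configuration, point) → ℝ≥0∞` be a
jointly measurable mark on configurations `μ : Measure ℝ³`.  Then there is a Giry-measurable
functional `Φ : Measure ℝ³ → ℝ≥0∞` which agrees with `μ ↦ ∫⁻ y, k μ y ∂μ` on every rooted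
`δ`-hard-core configuration (`IsRootedHardCore δ μ`: `μ` is the counting measure of a `δ`-separated
point set containing the root `0`).

**Proof.**  The identity "kernel" `μ ↦ μ` is not s-finite on all measures, so the raw functional
need not be measurable; but the landed truncation `trunc δ μ` (the configuration `μ` if it satisfies
the packing bounds `μ(B̄(0,n)) ≤ (2n/δ+1)³`, else `0`) is an s-finite kernel, whence
`(μ, a) ↦ ∫⁻ z, k a z ∂(trunc δ μ)` is jointly measurable (`EnergyFloor.measurable_lintegral_trunc`).
Take `Φ μ = ∫⁻ y, k μ y ∂(trunc δ μ)`, measurable by composing with the diagonal `μ ↦ (μ, μ)`; on a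
rooted `δ`-hard-core `μ` the packing bounds hold (`EnergyFloor.mem_hcClass_of_hc`), so
`trunc δ μ = μ` (`EnergyFloor.trunc_of_mem`) and `Φ μ = ∫⁻ y, k μ y ∂μ`.  All `[folklore]`.
-/

noncomputable section

open MeasureTheory
open scoped ENNReal

namespace Summit.AtomisticToContinuum.Crystallization.Theorems.PalmGoodLaw.MarkMeasurable

open Literature.Probability.Process (IsRootedHardCore)
open Summit.AtomisticToContinuum.Crystallization.Theorems.PalmUnimodularRigidityMinimiserShells.EnergyFloor
  (trunc trunc_of_mem mem_hcClass_of_hc measurable_lintegral_trunc)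

/-- **stub_markMeasurable** (T2 of line `palm-good-law`): MEASURABLE VERSIONS OF MARK FUNCTIONALS.
For `δ > 0` and a jointly measurable `k : (configuration, point) → ℝ≥0∞`, the functional
`μ ↦ ∫⁻ y, k μ y ∂μ` agrees on every rooted `δ`-hard-core configuration with a Giry-measurable `Φ`:
take `Φ μ = ∫⁻ y, k μ y ∂(trunc δ μ)` (s-finite truncated configuration kernel,
`measurable_lintegral_trunc` composed with the diagonal `μ ↦ (μ, μ)`), and on the hard-core class
`trunc δ μ = μ` (`trunc_of_mem`, `mem_hcClass_of_hc`). [folklore] -/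
theorem stub_markMeasurable :
    ∀ δ : ℝ, 0 < δ → ∀ k : Measure (EuclideanSpace ℝ (Fin 3)) → EuclideanSpace ℝ (Fin 3) → ℝ≥0∞,
      Measurable (Function.uncurry k) →
      ∃ Φ : Measure (EuclideanSpace ℝ (Fin 3)) → ℝ≥0∞, Measurable Φ ∧
        ∀ μ : Measure (EuclideanSpace ℝ (Fin 3)), IsRootedHardCore δ μ → Φ μ = ∫⁻ y, k μ y ∂μ := by
  intro δ hδ k hk
  refine ⟨fun μ => ∫⁻ y, k μ y ∂(trunc δ μ), ?_, fun μ hμ => ?_⟩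
  · -- measurability: the jointly measurable `(μ, ν) ↦ ∫⁻ y, k ν y ∂(trunc δ μ)` along the diagonal
    exact (measurable_lintegral_trunc (δ := δ) (α := Measure (EuclideanSpace ℝ (Fin 3))) (k := k)
      hk).comp (measurable_id.prodMk measurable_id)
  · -- on a rooted `δ`-hard-core configuration the truncation changes nothing
    show ∫⁻ y, k μ y ∂(trunc δ μ) = ∫⁻ y, k μ y ∂μ
    rw [trunc_of_mem (mem_hcClass_of_hc hδ hμ)]

end Summit.AtomisticToContinuum.Crystallization.Theorems.PalmGoodLaw.MarkMeasurable

end
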